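import Mathlib
import HarnessLib

/-!
# The ISOLATION-WINDOW GAME of the K2(p) binary-cone slice: Hironaka's two corner moves `T_a`, `T_b` on the
# plane cannot keep a point legal (`σ > 1`) and outside the quadrant `Q = {α ≥ 1, β ≥ 1}` for ever unless the
# word is eventually constant (idea-4 g3 CARD I-4-8 §C «VERTEX LEMMA», kernel form)

[OURS · counted 0 · pure combinatorics · cell `res-dim4-pi`, K2(p) lane, SLICE C (binary cones, `1 ≤ d < p`,
`e_G ≡ 2`; file-holder res-dim4-p-5 g3; card res-dim4-idea-4 g3 I-4-8 §C, graded THEOREM-GRADE by crit-2 g2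
V-B-45 and re-derived by crit-1 g2 V-A-32).]  Nothing here is a statement about resolution of singularities in
dimension ≥ 4 / characteristic `p`, which is NOT proved; nothing here proves K2(p).

THE GAME.  A point of Hironaka's characteristic polyhedron `Δ(G; x_a, x_b; y₁, y₂) ⊂ ℝ²_{≥ 0}` of the residual
threefold `V(G)` is `(α, β) = (A/n, B/n)`; the two PURE CORNER point blow-ups of a constant-`(d, e_G = 2)` tail act
on it by the classical affine maps ([CJS 2020] Lemma 13.2 / 13.4 = Hironaka 1967)
`T_a (α, β) = (α + β − 1, β)`, `T_b (α, β) = (α, α + β − 1)`, i.e. on numerators over the common denominator `n`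
`T_a (A, B) = (A + B − n, B)`, `T_b (A, B) = (A, A + B − n)`.  LEGAL = `σ := α + β > 1` (`n < A + B`: the cone is
the binary form); the quadrant `Q = {α ≥ 1 ∧ β ≥ 1}` (`n ≤ A ∧ n ≤ B`) is absorbing and `σ ≥ 2` on it.  The card's
§B reads `p`-fold ISOLATION of the child as «some generating point has `σ < 2`», hence «some point outside `Q`».

THE LEMMA (this file, def-free: the trajectory `q : ℕ → ℕ × ℕ` of numerators is any sequence satisfying the step
equation for the word `w : ℕ → Bool`, `true = T_a`, `false = T_b`):
* `WindowGame.sum_add_le_of_lt_of_lt` — in the square `A < n ∧ B < n` the point stays there and `σ` drops by `≥ 1`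
  per step whatever the word: illegal within `σ` steps (`not_lt_and_lt`);
* `WindowGame.side_of_outside` — a legal trajectory never meeting `Q` lives for ever on ONE side
  `{n ≤ A ∧ B < n}` or `{A < n ∧ n ≤ B}`;
* `WindowGame.phi_succ_le`, `WindowGame.phi_succ_add_one_le` — on the side `{n ≤ A, B < n}` the potential
  `Φ = A + (n − B)` never rises and drops at every `T_a`; hence `eventually_false_of_side` and, by the coordinate
  swap, **`WindowGame.eventually_constant`**: a legal trajectory that never enters `Q` has an EVENTUALLY CONSTANT word;
* **`WindowGame.eventually_constant_of_finite_family`** / **`…_of_window`** — for finitely many points moved by the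
  SAME word, all legal for ever, with at every time SOME point outside `Q` (resp. with `σ < 2`), the word is
  eventually constant; equivalently (`all_absorbed_of_not_eventually_constant`) a word with infinitely many letter
  changes puts every point into `Q` from some time on;
* §3 (appended) DEADLINE / LOCAL forms `exists_deadline`, **`eventually_constant_of_finite_family_local`**,
  `eventually_constant_of_window_local`: per-point denominators `n i`, and legality is only required along the
  past of each time's witness (live monomials), never after a monomial's death by cleaning.
In the line of CARD I-4-8 the eventually constant word is a FREE TAIL, excluded by the tree's FT(p,p)
(`FreeTailProof.noIsolatedFreeTailAt_self`); the polyhedron transport itself (W-frame, no births) is NOT in this file.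
[cite: CossartJannsenSaito2020, Lemma 13.2, Lemma 13.4, Thm. 13.7]
bears_on: LADDER-RESOLUTION:D157-DOOR2 (res-dim4-pi · K2(p) = `RidgeBudget.NoAboveFloorTrap p p` · slice C).
Supports stmt-ResolutionOfSingularities-16155 (helper).
-/

set_option linter.dupNamespace false -- mandated namespace of this single-conjunct summit

namespace Summit.ResolutionOfSingularities.ResolutionOfSingularities.Theorems.PIDim4

namespace WindowGame

/-! ## 1. One point: the square is fatal, the quadrant is absorbing, the sides are traps of one letter -/

section OnePoint

variable {n : ℕ} {w : ℕ → Bool} {q : ℕ → ℕ × ℕ}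
  (hstep : ∀ t, q (t + 1) =
    if w t then ((q t).1 + (q t).2 - n, (q t).2) else ((q t).1, (q t).1 + (q t).2 - n))

include hstep

/-- In the square `A < n ∧ B < n` a legal trajectory stays in the square and `σ = A + B` loses at least `1` per
step, whatever the word. [cite: CossartJannsenSaito2020, Lemma 13.2] -/
theorem sum_add_le_of_lt_of_lt (hlow : ∀ t, n < (q t).1 + (q t).2) {t₀ : ℕ} (hA : (q t₀).1 < n)
    (hB : (q t₀).2 < n) (s : ℕ) :
    (q (t₀ + s)).1 < n ∧ (q (t₀ + s)).2 < n ∧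
      (q (t₀ + s)).1 + (q (t₀ + s)).2 + s ≤ (q t₀).1 + (q t₀).2 := by
  induction s with
  | zero => exact ⟨by simpa using hA, by simpa using hB, by simp⟩
  | succ s ih =>
    obtain ⟨h1, h2, h3⟩ := ih
    have h := hstep (t₀ + s)
    have hl := hlow (t₀ + s)
    rw [show t₀ + (s + 1) = t₀ + s + 1 by ring, h]
    by_cases hw : w (t₀ + s) = true
    · simp only [hw, if_true]
      refine ⟨by omega, h2, by omega⟩
    · simp only [hw, if_false, Bool.false_eq_true]
      refine ⟨h1, by omega, by omega⟩

/-- Hence a LEGAL trajectory (`n < A + B` for ever) is never in the square: it would be illegal within `σ` steps.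
[cite: CossartJannsenSaito2020, Lemma 13.2] -/
theorem not_lt_and_lt (hlow : ∀ t, n < (q t).1 + (q t).2) (t : ℕ) : ¬ ((q t).1 < n ∧ (q t).2 < n) := by
  rintro ⟨hA, hB⟩
  obtain ⟨-, -, h⟩ := sum_add_le_of_lt_of_lt hstep hlow hA hB ((q t).1 + (q t).2)
  have := hlow (t + ((q t).1 + (q t).2))
  omega

/-- The quadrant `Q = {n ≤ A ∧ n ≤ B}` is absorbing. [cite: CossartJannsenSaito2020, Lemma 13.2] -/
theorem quadrant_succ {t : ℕ} (hA : n ≤ (q t).1) (hB : n ≤ (q t).2) :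
    n ≤ (q (t + 1)).1 ∧ n ≤ (q (t + 1)).2 := by
  rw [hstep t]
  by_cases hw : w t = true
  · simp only [hw, if_true]; exact ⟨by omega, hB⟩
  · simp only [hw, if_false, Bool.false_eq_true]; exact ⟨hA, by omega⟩

/-- Once in the quadrant, always in the quadrant. [folklore] -/
theorem quadrant_of_le {t₀ t : ℕ} (ht : t₀ ≤ t) (hA : n ≤ (q t₀).1) (hB : n ≤ (q t₀).2) :
    n ≤ (q t).1 ∧ n ≤ (q t).2 := by
  induction t, ht using Nat.le_induction with
  | base => exact ⟨hA, hB⟩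
  | succ t _ ih => exact quadrant_succ hstep ih.1 ih.2

/-- A legal trajectory that never meets the quadrant and starts on the side `{n ≤ A, B < n}` stays on that side.
[cite: CossartJannsenSaito2020, Lemma 13.2] -/
theorem side_of_outside (hlow : ∀ t, n < (q t).1 + (q t).2) (hQ : ∀ t, (q t).1 < n ∨ (q t).2 < n)
    (h0 : n ≤ (q 0).1) (t : ℕ) : n ≤ (q t).1 ∧ (q t).2 < n := by
  induction t with
  | zero =>
    refine ⟨h0, ?_⟩
    rcases hQ 0 with h | h
    · omega
    · exact h
  | succ t ih =>
    have hsq := not_lt_and_lt hstep hlow (t + 1)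
    have hQ' := hQ (t + 1)
    have h := hstep t
    by_cases hw : w t = true
    · simp only [hw, if_true] at h
      have h2 : (q (t + 1)).2 = (q t).2 := by rw [h]
      refine ⟨?_, by omega⟩
      by_contra hA
      exact hsq ⟨by omega, by omega⟩
    · simp only [hw, if_false, Bool.false_eq_true] at h
      have h1 : (q (t + 1)).1 = (q t).1 := by rw [h]
      refine ⟨by omega, ?_⟩
      rcases hQ' with h' | h'
      · omega
      · exact h'

/-- On the side `{n ≤ A, B < n}` the potential `Φ = A + (n − B)` never rises …
[cite: CossartJannsenSaito2020, Lemma 13.2] -/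
theorem phi_succ_le (hside : ∀ t, n ≤ (q t).1 ∧ (q t).2 < n) (t : ℕ) :
    (q (t + 1)).1 + (n - (q (t + 1)).2) ≤ (q t).1 + (n - (q t).2) := by
  have ht := hside t
  have ht1 := hside (t + 1)
  have h := hstep t
  by_cases hw : w t = true
  · simp only [hw, if_true] at h
    rw [h] at ht1 ⊢
    simp only at ht1 ⊢
    omega
  · simp only [hw, if_false, Bool.false_eq_true] at h
    rw [h] at ht1 ⊢
    simp only at ht1 ⊢
    omega

/-- … and drops at every `T_a`-step. [cite: CossartJannsenSaito2020, Lemma 13.2] -/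
theorem phi_succ_add_one_le (hside : ∀ t, n ≤ (q t).1 ∧ (q t).2 < n) {t : ℕ} (hw : w t = true) :
    (q (t + 1)).1 + (n - (q (t + 1)).2) + 1 ≤ (q t).1 + (n - (q t).2) := by
  have ht := hside t
  have ht1 := hside (t + 1)
  have h := hstep t
  simp only [hw, if_true] at h
  rw [h] at ht1 ⊢
  simp only at ht1 ⊢
  omega

/-- The potential is antitone along the trajectory. [folklore] -/
theorem phi_le_of_le (hside : ∀ t, n ≤ (q t).1 ∧ (q t).2 < n) {t t' : ℕ} (h : t ≤ t') :
    (q t').1 + (n - (q t').2) ≤ (q t).1 + (n - (q t).2) := by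
  induction t', h using Nat.le_induction with
  | base => exact le_rfl
  | succ t' _ ih => exact (phi_succ_le hstep hside t').trans ih

/-- **One letter only, on a side**: a trajectory living on the side `{n ≤ A, B < n}` makes only finitely many
`T_a`-steps — its word is eventually `T_b`. [cite: CossartJannsenSaito2020, Lemma 13.2, Thm. 13.7] -/
theorem eventually_false_of_side (hside : ∀ t, n ≤ (q t).1 ∧ (q t).2 < n) :
    ∃ T, ∀ t, T ≤ t → w t = false := by
  by_contra hne
  push Not at hne
  -- infinitely many `a`-steps make the potential drop below `0`
  have key : ∀ m, ∃ t, (q t).1 + (n - (q t).2) + m ≤ (q 0).1 + (n - (q 0).2) := by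
    intro m
    induction m with
    | zero => exact ⟨0, by simp⟩
    | succ m ih =>
      obtain ⟨t, ht⟩ := ih
      obtain ⟨t', htt', hwt'⟩ := hne t
      have hw : w t' = true := by simpa using hwt'
      have h1 := phi_succ_add_one_le hstep hside hw
      have h2 := phi_le_of_le hstep hside htt'
      exact ⟨t' + 1, by omega⟩
  obtain ⟨t, ht⟩ := key ((q 0).1 + (n - (q 0).2) + 1)
  omega

end OnePoint

/-- **THE VERTEX LEMMA, one point** (CARD I-4-8 §C): a trajectory of `T_a`/`T_b` that is legal for ever
(`n < A + B`) and never enters the quadrant `Q = {n ≤ A ∧ n ≤ B}` has an eventually constant word — the point is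
eventually fixed by one letter, and the other letter is never played again.
[cite: CossartJannsenSaito2020, Lemma 13.2, Lemma 13.4, Thm. 13.7] -/
theorem eventually_constant (n : ℕ) (w : ℕ → Bool) (q : ℕ → ℕ × ℕ)
    (hstep : ∀ t, q (t + 1) =
      if w t then ((q t).1 + (q t).2 - n, (q t).2) else ((q t).1, (q t).1 + (q t).2 - n))
    (hlow : ∀ t, n < (q t).1 + (q t).2) (hQ : ∀ t, (q t).1 < n ∨ (q t).2 < n) :
    ∃ (T : ℕ) (c : Bool), ∀ t, T ≤ t → w t = c := by
  rcases Nat.lt_or_ge (q 0).1 n with hA | hA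
  · -- the point starts (hence lives) on the side `{A < n, n ≤ B}`: swap the coordinates and the letters
    have hB : n ≤ (q 0).2 := by
      by_contra hB
      exact not_lt_and_lt hstep hlow 0 ⟨hA, by omega⟩
    set q' : ℕ → ℕ × ℕ := fun t => ((q t).2, (q t).1) with hq'
    set w' : ℕ → Bool := fun t => !(w t) with hw'
    have hstep' : ∀ t, q' (t + 1) =
        if w' t then ((q' t).1 + (q' t).2 - n, (q' t).2) else ((q' t).1, (q' t).1 + (q' t).2 - n) := by
      intro t
      simp only [hq', hw']
      rw [hstep t]
      by_cases hw : w t = true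
      · simp only [hw, if_true, Bool.not_true, Bool.false_eq_true, if_false, Prod.mk.injEq]
        exact ⟨trivial, by omega⟩
      · simp only [hw, if_false, Bool.false_eq_true, Bool.not_false, if_true, Prod.mk.injEq]
        exact ⟨by omega, trivial⟩
    have hlow' : ∀ t, n < (q' t).1 + (q' t).2 := fun t => by
      simp only [hq']
      have := hlow t
      omega
    have hQ'' : ∀ t, (q' t).1 < n ∨ (q' t).2 < n := fun t => by
      simp only [hq']
      exact (hQ t).symm
    have hside' := side_of_outside hstep' hlow' hQ'' (by simpa [hq'] using hB)
    obtain ⟨T, hT⟩ := eventually_false_of_side hstep' hside'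
    refine ⟨T, true, fun t ht => ?_⟩
    have := hT t ht
    simpa [hw'] using this
  · have hside := side_of_outside hstep hlow hQ hA
    obtain ⟨T, hT⟩ := eventually_false_of_side hstep hside
    exact ⟨T, false, hT⟩

/-! ## 2. Finitely many points moved by one word -/

/-- **A word with infinitely many changes absorbs every legal point into the quadrant** (finitely many points,
same word). [cite: CossartJannsenSaito2020, Lemma 13.2, Thm. 13.7] -/
theorem all_absorbed_of_not_eventually_constant {ι : Type*} [Finite ι] (n : ℕ) (w : ℕ → Bool)
    (q : ι → ℕ → ℕ × ℕ)
    (hstep : ∀ i t, q i (t + 1) =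
      if w t then ((q i t).1 + (q i t).2 - n, (q i t).2) else ((q i t).1, (q i t).1 + (q i t).2 - n))
    (hlow : ∀ i t, n < (q i t).1 + (q i t).2) (hw : ¬ ∃ (T : ℕ) (c : Bool), ∀ t, T ≤ t → w t = c) :
    ∃ T, ∀ i t, T ≤ t → n ≤ (q i t).1 ∧ n ≤ (q i t).2 := by
  classical
  -- every point meets the quadrant at some time, and stays
  have hmeet : ∀ i, ∃ t₀, n ≤ (q i t₀).1 ∧ n ≤ (q i t₀).2 := by
    intro i
    by_contra h
    push Not at h
    exact hw (eventually_constant n w (q i) (hstep i) (hlow i) fun t => by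
      by_cases hA : (q i t).1 < n
      · exact Or.inl hA
      · exact Or.inr (h t (by omega)))
  choose t₀ ht₀ using hmeet
  haveI := Fintype.ofFinite ι
  refine ⟨Finset.univ.sup t₀, fun i t ht => ?_⟩
  have hi : t₀ i ≤ t := (Finset.le_sup (f := t₀) (Finset.mem_univ i)).trans ht
  exact quadrant_of_le (hstep i) hi (ht₀ i).1 (ht₀ i).2

/-- **THE VERTEX LEMMA, finite family** (CARD I-4-8 §C): finitely many points moved by the same word, all legal
for ever, with at every time SOME point outside the quadrant — then the word is eventually constant.
[cite: CossartJannsenSaito2020, Lemma 13.2, Lemma 13.4, Thm. 13.7] -/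
theorem eventually_constant_of_finite_family {ι : Type*} [Finite ι] (n : ℕ) (w : ℕ → Bool)
    (q : ι → ℕ → ℕ × ℕ)
    (hstep : ∀ i t, q i (t + 1) =
      if w t then ((q i t).1 + (q i t).2 - n, (q i t).2) else ((q i t).1, (q i t).1 + (q i t).2 - n))
    (hlow : ∀ i t, n < (q i t).1 + (q i t).2) (hout : ∀ t, ∃ i, (q i t).1 < n ∨ (q i t).2 < n) :
    ∃ (T : ℕ) (c : Bool), ∀ t, T ≤ t → w t = c := by
  by_contra hw
  obtain ⟨T, hT⟩ := all_absorbed_of_not_eventually_constant n w q hstep hlow hw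
  obtain ⟨i, hi⟩ := hout T
  have := hT i T le_rfl
  omega

/-- **THE ISOLATION WINDOW** `1 < δ < 2` (CARD I-4-8 §B/§C): finitely many points moved by the same word with
`n < A + B` for every point at every time (lower wall: the cone is the binary form) and `A + B < 2n` for SOME point
at every time (upper wall: the child is an isolated `p`-fold point) force an eventually constant word.
[cite: CossartJannsenSaito2020, Lemma 12.3, Lemma 13.2, Thm. 13.7] -/
theorem eventually_constant_of_window {ι : Type*} [Finite ι] (n : ℕ) (w : ℕ → Bool) (q : ι → ℕ → ℕ × ℕ)
    (hstep : ∀ i t, q i (t + 1) =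
      if w t then ((q i t).1 + (q i t).2 - n, (q i t).2) else ((q i t).1, (q i t).1 + (q i t).2 - n))
    (hlow : ∀ i t, n < (q i t).1 + (q i t).2) (hup : ∀ t, ∃ i, (q i t).1 + (q i t).2 < 2 * n) :
    ∃ (T : ℕ) (c : Bool), ∀ t, T ≤ t → w t = c :=
  eventually_constant_of_finite_family n w q hstep hlow fun t => by
    obtain ⟨i, hi⟩ := hup t
    exact ⟨i, by omega⟩

/-! ## 3. Deadline forms: legality is only needed UNTIL absorption (monomials may die later), and every
point may carry its own denominator (the level `n = d − |passive exponents|` of the generating point) -/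

/-- **DEADLINE FORM, one point**: if the word is NOT eventually constant, every trajectory has a time `T` such
that legality on `[0, T]` alone forces the point into the quadrant at time `T` (after which it stays, by
`quadrant_of_le`, with no legality needed). [cite: CossartJannsenSaito2020, Lemma 13.2, Thm. 13.7] -/
theorem exists_deadline (n : ℕ) (w : ℕ → Bool) (q : ℕ → ℕ × ℕ)
    (hstep : ∀ t, q (t + 1) =
      if w t then ((q t).1 + (q t).2 - n, (q t).2) else ((q t).1, (q t).1 + (q t).2 - n))
    (hw : ¬ ∃ (T : ℕ) (c : Bool), ∀ t, T ≤ t → w t = c) :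
    ∃ T, (∀ t, t ≤ T → n < (q t).1 + (q t).2) → n ≤ (q T).1 ∧ n ≤ (q T).2 := by
  by_contra h
  push Not at h
  refine hw (eventually_constant n w q hstep (fun t => (h t).1 t le_rfl) fun t => ?_)
  have h2 := (h t).2
  by_cases hA : (q t).1 < n
  · exact Or.inl hA
  · right
    have : ¬ (n ≤ (q t).1 ∧ n ≤ (q t).2) := by simpa using h2
    omega

/-- **THE VERTEX LEMMA, finite family, LOCAL form** (per-point denominators `n i`, legality only along the
witness's past): finitely many points moved by the same word; if at every time `t` SOME point is outside its
quadrant and has been legal at all times `≤ t`, the word is eventually constant.  (In the K2(p) line the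
witness at time `t` is a LIVE monomial of the parent with `σ < 2`, alive — hence legal — since the founding
state; dead monomials are never consulted.) [cite: CossartJannsenSaito2020, Lemma 13.2, Lemma 13.4, Thm. 13.7] -/
theorem eventually_constant_of_finite_family_local {ι : Type*} [Finite ι] (n : ι → ℕ) (w : ℕ → Bool)
    (q : ι → ℕ → ℕ × ℕ)
    (hstep : ∀ i t, q i (t + 1) =
      if w t then ((q i t).1 + (q i t).2 - n i, (q i t).2) else ((q i t).1, (q i t).1 + (q i t).2 - n i))
    (hwit : ∀ t, ∃ i, (∀ t', t' ≤ t → n i < (q i t').1 + (q i t').2) ∧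
      ((q i t).1 < n i ∨ (q i t).2 < n i)) :
    ∃ (T : ℕ) (c : Bool), ∀ t, T ≤ t → w t = c := by
  classical
  by_contra hw
  have hdl : ∀ i, ∃ T, (∀ t, t ≤ T → n i < (q i t).1 + (q i t).2) → n i ≤ (q i T).1 ∧ n i ≤ (q i T).2 :=
    fun i => exists_deadline (n i) w (q i) (hstep i) hw
  choose T hT using hdl
  haveI := Fintype.ofFinite ι
  obtain ⟨i, hleg, hout⟩ := hwit (Finset.univ.sup T)
  have hi : T i ≤ Finset.univ.sup T := Finset.le_sup (f := T) (Finset.mem_univ i)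
  have hQ := hT i fun t ht => hleg t (ht.trans hi)
  have := quadrant_of_le (hstep i) hi hQ.1 hQ.2
  omega

/-- **THE ISOLATION WINDOW, LOCAL form**: as `eventually_constant_of_finite_family_local` with the upper
wall read as `A + B < 2·n i` for the witness. [cite: CossartJannsenSaito2020, Lemma 12.3, Lemma 13.2, Thm. 13.7] -/
theorem eventually_constant_of_window_local {ι : Type*} [Finite ι] (n : ι → ℕ) (w : ℕ → Bool)
    (q : ι → ℕ → ℕ × ℕ)
    (hstep : ∀ i t, q i (t + 1) =
      if w t then ((q i t).1 + (q i t).2 - n i, (q i t).2) else ((q i t).1, (q i t).1 + (q i t).2 - n i))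
    (hwit : ∀ t, ∃ i, (∀ t', t' ≤ t → n i < (q i t').1 + (q i t').2) ∧
      (q i t).1 + (q i t).2 < 2 * n i) :
    ∃ (T : ℕ) (c : Bool), ∀ t, T ≤ t → w t = c :=
  eventually_constant_of_finite_family_local n w q hstep fun t => by
    obtain ⟨i, hleg, hup⟩ := hwit t
    exact ⟨i, hleg, by omega⟩

end WindowGame

end Summit.ResolutionOfSingularities.ResolutionOfSingularities.Theorems.PIDim4
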